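import Literature.NumberTheory.Weil1964.RealWeilIndexEquivalence
import Mathlib.Analysis.Calculus.BumpFunction.FiniteDimension
import Mathlib.Analysis.Calculus.BumpFunction.Normed
import Mathlib.Analysis.SpecialFunctions.Complex.Log
import HarnessLib

/-!
# Weil's index of a real symmetric form: congruent Gram matrices and the signature mod 8

Topic `NumberTheory/Weil1964`; namespace `Literature.NumberTheory.Weil1964`. KERNEL mathematics only
(theorems; no definition, no named fact, no `axiom`, no `sorry`). Sequel of `RealWeilIndexEquivalence.lean`
(`realWeilIndexSymm hS = ∏ γ(e^{2πi λᵢ x²})` over the eigenvalues of a real symmetric Gram matrix `S`, with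
Weil's Corollaire 2 `weil_corollary2_symm` and the change of variables `weil_corollary2_pi_comp_linearEquiv`).

* §1 For EVERY symmetric `S` (degenerate allowed) the index is `e^{iπ σ/4}` where `σ = ∑ sgn λᵢ` is the
  signature `a - b` (zero eigenvalues do not contribute, `γ(0 · x²) = 1`): [Weil1964, Chap. II n° 26 p. 173]
  "si `f` a le type d'inertie `(a, b)`, `γ(f) = γ(q₁)^{a-b}`" with `γ(q₁) = e^{πi/4}` (`realWeilIndexSymm_eq_cexp_signature`).
* §2 **Congruent Gram matrices have the same index** ([Weil1964, Chap. II n° 25 p. 173]: "si `f' = f ∘ α` … `γ(f') = γ(f)`;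
  `γ` a même valeur pour deux formes équivalentes"): for `S` symmetric invertible and `P` invertible,
  `realWeilIndexSymm (Pᵀ S P) = realWeilIndexSymm S` (`realWeilIndexSymm_congr`) — proved, as Weil does, from
  the DEFINITION of `γ` by Théorème 2 / Corollaire 2: both sides are the scalar of Corollaire 2 for the same
  second-degree character `f_S ∘ P` (tested against one compactly supported smooth `Φ` with `∫ Φ ≠ 0`), and that
  scalar is unique. No use of Sylvester's law of inertia (absent from Mathlib).
* §3 Consequently the signature of an invertible real symmetric matrix is a congruence invariant **modulo 8**
  (`sum_sign_eigenvalues_congr_mod_eight`) — the shadow of Sylvester's law that Weil's eighth root of unity sees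
  ("dans tous les cas, `γ(f)` est une racine huitième de l'unité", n° 26 p. 174).

## References

* [Weil1964] A. Weil, *Sur certains groupes d'opérateurs unitaires*, Acta Math. 111 (1964) 143–211: Chap. I
  n° 14 Théorème 2 / Corollaire 2 (pp. 161–162); Chap. II n° 25 (p. 173), n° 26 (pp. 173–174).
-/

set_option autoImplicit false

noncomputable section

open MeasureTheory Complex Filter Topology Set Finset
open scoped Real FourierTransform SchwartzMap BigOperators ComplexConjugate Matrix

namespace Literature.NumberTheory.Weil1964

variable {ι : Type*} [Fintype ι]

/-! ## §1 The index of an arbitrary symmetric Gram matrix as `e^{iπ σ/4}` -/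

/-- the junk value of the one-variable index at the degenerate form is `1`, so zero eigenvalues do not
contribute to `realWeilIndexSymm`. [cite: Weil1964, Chap. II n° 26, p. 174] -/
theorem realWeilIndex_zero_eq_one : realWeilIndex 0 = 1 := by
  simp [realWeilIndex]

/-- **`γ(f_S) = e^{iπ σ(S)/4}`, `σ(S) = ∑ᵢ sgn λᵢ = a - b`** for every real symmetric `S` (inertia `(a, b)`;
degenerate forms allowed: the index is that of the non-degenerate part).
[cite: Weil1964, Chap. II n° 26, pp. 173–174] -/
theorem realWeilIndexSymm_eq_cexp_signature [DecidableEq ι] {S : Matrix ι ι ℝ} (hS : S.IsHermitian) :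
    realWeilIndexSymm hS =
      cexp (((π / 4 * ∑ i, (SignType.sign (hS.eigenvalues i) : ℝ) : ℝ) : ℂ) * I) := by
  rw [realWeilIndexSymm_apply, realWeilIndexPi_eq_cexp]

/-- the index only sees the nonzero eigenvalues. [cite: Weil1964, Chap. II n° 26, p. 173] -/
theorem realWeilIndexSymm_eq_prod_filter [DecidableEq ι] {S : Matrix ι ι ℝ} (hS : S.IsHermitian) :
    realWeilIndexSymm hS = ∏ i ∈ Finset.univ.filter (fun i => hS.eigenvalues i ≠ 0),
      realWeilIndex (hS.eigenvalues i) := by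
  rw [realWeilIndexSymm_apply, realWeilIndexPi_apply, ← Finset.prod_filter_mul_prod_filter_not Finset.univ
    (fun i => hS.eigenvalues i ≠ 0)]
  conv_rhs => rw [← mul_one (∏ i ∈ Finset.univ.filter (fun i => hS.eigenvalues i ≠ 0),
    realWeilIndex (hS.eigenvalues i))]
  congr 1
  refine Finset.prod_eq_one fun i hi => ?_
  rw [Finset.mem_filter, not_not] at hi
  rw [hi.2, realWeilIndex_zero_eq_one]

/-! ## §2 Congruent Gram matrices: `γ(f_{Pᵀ S P}) = γ(f_S)` -/

/-- a compactly supported smooth test function with non-vanishing integral on `ℝ^ι` (a bump function), as a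
complex-valued Schwartz function. [folklore] -/
private theorem exists_schwartz_integral_ne_zero : ∃ Φ : 𝓢((ι → ℝ), ℂ), ∫ x, Φ x ≠ 0 := by
  let f : ContDiffBump (0 : ι → ℝ) := ⟨1, 2, zero_lt_one, one_lt_two⟩
  have h1 : HasCompactSupport (fun x : ι → ℝ => ((f x : ℝ) : ℂ)) :=
    f.hasCompactSupport.comp_left Complex.ofReal_zero
  have h2 : ContDiff ℝ (⊤ : ℕ∞) (fun x : ι → ℝ => ((f x : ℝ) : ℂ)) :=
    (Complex.ofRealCLM.contDiff.of_le le_top).comp f.contDiff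
  refine ⟨h1.toSchwartzMap h2, ?_⟩
  rw [show (⇑(h1.toSchwartzMap h2) : (ι → ℝ) → ℂ) = fun x => ((f x : ℝ) : ℂ) from rfl, integral_complex_ofReal]
  exact_mod_cast (f.integral_pos (μ := (volume : Measure (ι → ℝ)))).ne'

/-- an orthogonal matrix has `|det| = 1`. [folklore] -/
private theorem abs_det_eq_one_of_mem_unitaryGroup' [DecidableEq ι] {U : Matrix ι ι ℝ}
    (hU : U ∈ Matrix.unitaryGroup ι ℝ) : |U.det| = 1 := by
  have h := (Unitary.mem_iff.1 (Matrix.det_of_mem_unitary hU)).1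
  rw [star_trivial] at h
  rcases mul_self_eq_one_iff.1 h with h1 | h1 <;> simp [h1]

/-- **Corollaire 2 for the congruent form `f_{Pᵀ S P} = f_S ∘ P`**, with the scalar of `S`: for `S` symmetric
invertible with eigenvalues `λ` and `P` invertible,
`∫∫ Φ(u) f_{PᵀSP}(x - u) du dx = γ(f_S) |det P|⁻¹ ∏|2λᵢ|^{-1/2} ∫ Φ`. [cite: Weil1964, Chap. II n° 25, p. 173] -/
theorem weil_corollary2_symm_congr [DecidableEq ι] {S : Matrix ι ι ℝ} (hS : S.IsHermitian)
    (hdet : S.det ≠ 0) {P : Matrix ι ι ℝ} (hP : P.det ≠ 0) (Φ : 𝓢((ι → ℝ), ℂ)) :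
    ∫ x : ι → ℝ, ∫ u : ι → ℝ, Φ u * symmChirp (Pᵀ * S * P) (x - u) =
      realWeilIndexSymm hS * ((∏ i, |2 * hS.eigenvalues i| ^ (-(1 / 2 : ℝ)) : ℝ) : ℂ) *
        ((|P.det|⁻¹ : ℝ) : ℂ) * ∫ x : ι → ℝ, Φ x := by
  set U : Matrix ι ι ℝ := (hS.eigenvectorUnitary : Matrix ι ι ℝ) with hU
  -- `f_{PᵀSP} = f_S ∘ P = f_{diag λ} ∘ (Uᵀ P)`
  have hchar : ∀ v : ι → ℝ, symmChirp (Pᵀ * S * P) v = realChirpPi hS.eigenvalues ((Uᵀ * P) *ᵥ v) :=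
    fun v => by
    rw [symmChirp_transpose_mul_mul, symmChirp_eq_realChirpPi_eigenvalues hS, ← hU, Matrix.mulVec_mulVec]
  have hdetUP : LinearMap.det (Matrix.toLin' (Uᵀ * P)) ≠ 0 := by
    rw [LinearMap.det_toLin', Matrix.det_mul, Matrix.det_transpose]
    refine mul_ne_zero ?_ hP
    have h1 := abs_det_eq_one_of_mem_unitaryGroup' hS.eigenvectorUnitary.2
    rw [← hU] at h1
    intro h0
    rw [h0, abs_zero] at h1
    exact zero_ne_one h1
  set A : (ι → ℝ) ≃ₗ[ℝ] (ι → ℝ) := LinearMap.equivOfDetNeZero (Matrix.toLin' (Uᵀ * P)) hdetUP with hA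
  have hAx : ∀ v : ι → ℝ, (Uᵀ * P) *ᵥ v = A v := fun v => by
    rw [hA]
    exact (Matrix.toLin'_apply _ _).symm
  have hAdet : |LinearMap.det (A : (ι → ℝ) →ₗ[ℝ] (ι → ℝ))| = |P.det| := by
    rw [hA, show ((LinearMap.equivOfDetNeZero (Matrix.toLin' (Uᵀ * P)) hdetUP : (ι → ℝ) ≃ₗ[ℝ] (ι → ℝ)) :
        (ι → ℝ) →ₗ[ℝ] (ι → ℝ)) = Matrix.toLin' (Uᵀ * P) from rfl, LinearMap.det_toLin', Matrix.det_mul,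
      Matrix.det_transpose, abs_mul, hU, abs_det_eq_one_of_mem_unitaryGroup' hS.eigenvectorUnitary.2, one_mul]
  have hev : ∀ i, hS.eigenvalues i ≠ 0 := fun i => by
    have h := hS.det_eq_prod_eigenvalues
    rw [h] at hdet
    simpa using Finset.prod_ne_zero_iff.1 hdet i (Finset.mem_univ i)
  simp_rw [hchar, hAx]
  rw [weil_corollary2_pi_comp_linearEquiv hev A Φ, hAdet, realWeilIndexSymm_apply]

/-- the module factors: `|det (2 PᵀSP)|^{-1/2} = |det P|⁻¹ ∏ |2λᵢ|^{-1/2}`. [folklore] -/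
private theorem abs_det_congr_rpow [DecidableEq ι] {S : Matrix ι ι ℝ} (hS : S.IsHermitian) (P : Matrix ι ι ℝ)
    (hP : P.det ≠ 0) :
    |((2 : ℝ) • (Pᵀ * S * P)).det| ^ (-(1 / 2 : ℝ)) =
      (∏ i, |2 * hS.eigenvalues i| ^ (-(1 / 2 : ℝ))) * |P.det|⁻¹ := by
  have hdet2 : ((2 : ℝ) • (Pᵀ * S * P)).det = P.det ^ 2 * ∏ i, (2 * hS.eigenvalues i) := by
    rw [Matrix.det_smul, Matrix.det_mul, Matrix.det_mul, Matrix.det_transpose, hS.det_eq_prod_eigenvalues,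
      Finset.prod_mul_distrib, Finset.prod_const, Finset.card_univ]
    simp only [RCLike.ofReal_real_eq_id, id_eq]
    ring
  have hPpos : 0 < |P.det| := abs_pos.2 hP
  rw [hdet2, abs_mul, abs_pow, Finset.abs_prod, Real.mul_rpow (by positivity)
      (Finset.prod_nonneg fun i _ => abs_nonneg _),
    Real.finsetProd_rpow _ _ (fun i _ => abs_nonneg _), mul_comm]
  congr 1
  rw [show (|P.det| ^ 2 : ℝ) = |P.det| ^ (2 : ℝ) by rw [Real.rpow_two], ← Real.rpow_mul hPpos.le,
    show (2 : ℝ) * -(1 / 2) = -1 by norm_num, Real.rpow_neg_one]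

/-- **congruent Gram matrices have the same Weil index**: `γ(f_{PᵀSP}) = γ(f_S)` for `S` symmetric invertible
and `P` invertible ("`γ` a même valeur pour deux formes équivalentes") — both are the scalar of Corollaire 2
for the character `f_S ∘ P`, which is unique. [cite: Weil1964, Chap. II n° 25, p. 173; Chap. I n° 14 Cor. 2, p. 162] -/
theorem realWeilIndexSymm_congr [DecidableEq ι] {S : Matrix ι ι ℝ} (hS : S.IsHermitian) (hdet : S.det ≠ 0)
    {P : Matrix ι ι ℝ} (hP : P.det ≠ 0) (hS' : (Pᵀ * S * P).IsHermitian) :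
    realWeilIndexSymm hS' = realWeilIndexSymm hS := by
  obtain ⟨Φ, hΦ⟩ := exists_schwartz_integral_ne_zero (ι := ι)
  have hdet' : (Pᵀ * S * P).det ≠ 0 := by
    rw [Matrix.det_mul, Matrix.det_mul, Matrix.det_transpose]
    exact mul_ne_zero (mul_ne_zero hP hdet) hP
  have h1 := weil_corollary2_symm hS' hdet' Φ
  have h2 := weil_corollary2_symm_congr hS hdet hP Φ
  rw [h1, abs_det_congr_rpow hS P hP, Complex.ofReal_mul, ← mul_assoc] at h2
  have hC : ((∏ i, |2 * hS.eigenvalues i| ^ (-(1 / 2 : ℝ)) : ℝ) : ℂ) ≠ 0 := by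
    have hev : ∀ i, hS.eigenvalues i ≠ 0 := fun i => by
      have h := hS.det_eq_prod_eigenvalues
      rw [h] at hdet
      simpa using Finset.prod_ne_zero_iff.1 hdet i (Finset.mem_univ i)
    exact_mod_cast (Finset.prod_pos fun i _ =>
      Real.rpow_pos_of_pos (abs_pos.2 (mul_ne_zero two_ne_zero (hev i))) _).ne'
  have hD : ((|P.det|⁻¹ : ℝ) : ℂ) ≠ 0 := by exact_mod_cast (inv_pos.2 (abs_pos.2 hP)).ne'
  exact mul_right_cancel₀ hC (mul_right_cancel₀ hD (mul_right_cancel₀ hΦ h2))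

/-! ## §3 The signature is a congruence invariant modulo 8 -/

/-- **Sylvester mod 8, through Weil's eighth root of unity**: for `S` symmetric invertible and `P` invertible,
the signatures `∑ sgn λᵢ` of `S` and of `Pᵀ S P` agree modulo `8` (`e^{iπσ/4}` is a congruence invariant).
[cite: Weil1964, Chap. II n° 25–26, pp. 173–174] -/
theorem sum_sign_eigenvalues_congr_mod_eight [DecidableEq ι] {S : Matrix ι ι ℝ} (hS : S.IsHermitian)
    (hdet : S.det ≠ 0) {P : Matrix ι ι ℝ} (hP : P.det ≠ 0) (hS' : (Pᵀ * S * P).IsHermitian) :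
    ∃ n : ℤ, (∑ i, (SignType.sign (hS'.eigenvalues i) : ℝ)) =
      (∑ i, (SignType.sign (hS.eigenvalues i) : ℝ)) + 8 * n := by
  have h := realWeilIndexSymm_congr hS hdet hP hS'
  rw [realWeilIndexSymm_eq_cexp_signature, realWeilIndexSymm_eq_cexp_signature,
    Complex.exp_eq_exp_iff_exists_int] at h
  obtain ⟨n, hn⟩ := h
  refine ⟨n, ?_⟩
  have him := congr_arg Complex.im hn
  simp only [Complex.mul_im, Complex.ofReal_re, Complex.ofReal_im, Complex.I_re, Complex.I_im,
    Complex.add_im, mul_zero, mul_one, zero_add, Complex.mul_re, Complex.intCast_re, Complex.intCast_im,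
    Complex.re_ofNat, Complex.im_ofNat, zero_mul, sub_zero] at him
  -- `him : π/4 * σ' = π/4 * σ + n * (2π)`
  have hπ : (π : ℝ) ≠ 0 := Real.pi_ne_zero
  field_simp at him
  simp only [mul_zero, add_zero] at him
  have key : (π : ℝ) * (∑ i, (SignType.sign (hS'.eigenvalues i) : ℝ)) =
      π * ((∑ i, (SignType.sign (hS.eigenvalues i) : ℝ)) + 8 * n) := by
    rw [him]
    ring
  exact mul_left_cancel₀ hπ key

end Literature.NumberTheory.Weil1964
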